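/-
Copyright (c) 2026 the pub-hodgecm-mathlib formalisation cell (harness21).  Prover seat hodgecm-mathlib-LH7-p10 (g2), req620 Track A «(D-RAM) FOUR-FRAME» squad
((β₂) road (R-36) «PURE-CELL LEDGER», β₂-BOARD v2 (00b5a5b7) row (L-Σ), β₂ WORD #16 rows (ROW-W) «THE ROW WINDOW» + (ROW-R) «A LABELLED VERTEX HAS TUBE DEPTH ≤ R»), 2026-09-04.
-/
import Summits.HodgeConjecture.HodgeConjecture.Theorems.F0P3cDyRamConeCellEmptyAtlas             -- ★ p861798 (this lineage, g0): the RamK u-free zero rows + (∅-2) `cellDiff_eq_zero_of_lt_add`; brings ★ p861746 `…_eq_zero_of_eq_empty`, ★ DEFS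
import Summits.HodgeConjecture.HodgeConjecture.Theorems.F0P3cDyRamFourFramePieces                 -- ★ DEFS: `endoGL` (the block element `Γ = ι(γ₂, u)`)
import Summits.HodgeConjecture.HodgeConjecture.Theorems.F0P3cDyRamFourFrameCensusDefs             -- ★ DEFS: `LatticeInLevel`, `LatticeNearTransvShell`
import Summits.HodgeConjecture.HodgeConjecture.Theorems.F0P3cDyRamStageOneBDefs                   -- ★ DEFS: `mstarOfRecord`, `mcOfRecord`
import Literature.NumberTheory.Automorphic.UnitaryLatticeTreeTypes                                -- ★ `eq_of_le_of_isVertexLattice` (comparable vertices of one type are equal)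
import HarnessLib

/-!
# Crux `H413`, line LH4 «(D-RAM) FOUR-FRAME» — (β₂) road, β₂-BOARD v2 row (L-Σ), WORD #16 rows (ROW-W) + (ROW-R): «THE ROW WINDOW OF THE RamK CONE LEDGER» —
# in ‹OFF.letter.v1›'s one-literal general-block currency: `lam ∈ 𝒪_j ⟺ j ≤ jl`, `m ≤ jl`, and `X(j,b) = 0` off the window (`j < b`; `j − b` odd; `jl < j + b` on the row; the
# anisotropic far rows `b + 2d ≤ j`; tube depths `b > R`)

Cell `hodgecm-mathlib` (D-0151), FLOOR 0, crux item H413 = `stmt-HodgeConjecture-24833`, route of record `HCCMUnconditional`; squads F0∕P3c∕LH4 + LH7; lane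
`--supports stmt-HodgeConjecture-24833 --as helper` (count-neutral; pays NO tier-0 row).  THEOREMS ONLY (no `def`, no instance, no notation, no `sorry`, default heartbeats);
★-only imports; states NO law.  GENERIC ∕ DATUM-FREE (no CM token): the binders are a SUBSET, BY NAME AND BYTE, of β₂ sub-dealer LH4-p04 (g9)'s ‹OFF.letter.v1› (c339e0c4) = the
one-literal general-block currency (`H₂, h_W, P₁, γ₂, u, φ, h, f, R` in ★ p861305 §3's spelling) of ★ p862801 `beta2ConesB_of_rows` ∕ ED. 3; `X(j, b)` below IS ‹OFF›'s two-finsum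
difference VERBATIM (`cellDiff` of the cone cell `(j, b)`: the weighted count of the `(ℓ₀, m*)`-shell `+`-labelled glued vertices over `levelSetDep(j, b; μ)` minus the `(ℓ₀, m_c)`-shell
non-`+` ones, `μ = lam − jE u₀₀`, `ℓ₀ = d % 2`).

WHAT IS PROVED (β₂ WORD #16 (ROW-W) + (ROW-R), dealt to this seat; every vanishing is LABEL-FREE and WEIGHT-FREE inside — the cell or the labelled subset is EMPTY):
* §1 (W0) `isOrd_lam_iff_le : IsOrd ρ α (jE ϖ ^ j) lam ↔ j ≤ jl` (`lam − ρ lam = μ − ρμ` since `ρ` fixes `jE u₀₀`; `|jE ϖ^j·(α − ρα)| = exp(−j)` in the RamK lane `|α − ρα| = 1`,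
  `|jE a| = |a|`) and `m_le_jl : m ≤ jl` (`|μ − ρμ| ≤ |μ|`).
* §2 THE WINDOW (★ p861798 atlas ∘ ★ p861746): (W1) `cellDiff_eq_zero_of_lt` (`j < b`: ★ `levelSet_eq_empty_of_lt_ramK`), (W2) `cellDiff_eq_zero_of_odd` (`b ≤ j`, `j − b` odd:
  ★ `levelSet_eq_empty_of_odd_ramK`), (W3) `cellDiff_eq_zero_of_lt_add_row` (`2b ≤ m`, `jl < j + b`: ★ `cellDiff_eq_zero_of_lt_add` with `m ≤ jl`; row-predicate free), (W4)
  `cellDiff_eq_zero_of_far_aniso` (anisotropic literal, `1 ≤ b`, `b + 2d ≤ j`, PARITY-FREE: ★ `levelSet_far_ramK_aniso_eq_empty` for `j − b` even, (W2) for odd).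
* §3 (ROW-R): `mapGL_eq_of_latticeInLevel` — a self-dual vertex `L₃` with `(Γ − 1)L₃ ⊆ ϖ^ℓ L₃` (the first conjunct of the shell label) is `Γ`-FIXED (`Γ L₃ ⊆ L₃`, both self-dual,
  ★ `isVertexLattice_mapGL` + ★ `eq_of_le_of_isVertexLattice`; `Γ = ι(γ₂, u) ∈ U(ι-shape(H₂, h_W))` by ★ `conj_mem_unitaryGroupOfForm_iff` on ‹OFF›'s `hΓ`, `hA`); hence
  `le_of_shell_of_tube` (R-vertex): such an `L₃` of tube depth `b` has `b ≤ R` (‹OFF›'s `hR`), and `cellDiff_eq_zero_of_lt_depth` (R-cell): `R < b ⇒ X(j, b) = 0` (both labelled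
  subsets EMPTY) — so on each literal the bare row sum equals its `Icc 1 R`-filtered one (ED. 3's «row outside the box ⇒ 0 = 0»).
HONEST LABEL.  Count-neutral index ∕ lattice bookkeeping over ★ tables; nothing printed is asserted; no census law is stated; ‹OFF›, ‹ROW›, (β₂) stay HYPOTHESES; `HC_CM` is proved only
modulo the 7 printed citations (2 remaining named inputs: hLiu418 = `stmt-HodgeConjecture-24832`, h413 = `stmt-HodgeConjecture-24833`) until rung 0 closes.
## References
* [Kottwitz1986BaseChangeUnits] R. E. Kottwitz, *Base change for unit elements of Hecke algebras*, Compositio Math. 60 (1986), §1 pp. 240–241 (cell-by-cell lattice counts), §3.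
* [Flicker1998UnitaryFL] Y. Z. Flicker, *Elementary proof of the fundamental lemma for a unitary group*, Canad. J. Math. 50 (1998), Prop. 7 p. 84.
* [Jacobowitz1962] R. Jacobowitz, *Hermitian forms over local fields*, Amer. J. Math. 84 (1962), §4, §7 (unimodular lattices are maximal).
* [Serre1979] J.-P. Serre, *Local Fields*, GTM 67 (1979), Ch. III §6 Prop. 12; Ch. V §3 Prop. 5, Cor. 2–3 pp. 84–86.
-/

set_option autoImplicit false

noncomputable section

namespace Summit.HodgeConjecture.HodgeConjecture.Cruxes.H413.F0P3cDyRamBeta2ConesRowWindow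

open scoped Matrix MatrixGroups Classical Valued WithZero
open WithZero
open Literature.NumberTheory.Automorphic Literature.NumberTheory.Automorphic.UnitaryThreeFourFrame Literature.NumberTheory.Automorphic.UnitaryLatticeTree
open Literature.NumberTheory.Automorphic.HermitianLattice Literature.NumberTheory.Automorphic.EllipticPlaneAsFieldLine Literature.NumberTheory.LocalFields.QuadraticOrder
open Literature.NumberTheory.Rogawski1990
open Summit.HodgeConjecture.HodgeConjecture.Cruxes.H413.F0P3cDyRamToricCensusDefs Summit.HodgeConjecture.HodgeConjecture.Cruxes.H413.F0P3cDyRamFourFramePieces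
open Summit.HodgeConjecture.HodgeConjecture.Cruxes.H413.F0P3cDyRamFourFrameCensusDefs Summit.HodgeConjecture.HodgeConjecture.Cruxes.H413.F0P3cDyRamStageOneBDefs
open Summit.HodgeConjecture.HodgeConjecture.Cruxes.H413.F0P3cDyRamConeCellBoundaryEmptyAtTwo (finsum_inter_sub_finsum_inter_eq_zero_of_eq_empty levelSetDep_eq_empty_of_levelSet_eq_empty)
open Summit.HodgeConjecture.HodgeConjecture.Cruxes.H413.F0P3cDyRamConeCellEmptyAtlas Summit.HodgeConjecture.HodgeConjecture.Cruxes.H413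

variable {E M : Type} [Field E] [Valued E ℤᵐ⁰] [Field M] [Valued M ℤᵐ⁰]
  {σ : E →+* E} {ϖ : E} {d tE : ℕ} {jE : E →+* M} {ρ Θ : M →+* M} {α lam : M} {γ₂ : GL (Fin 2) E} {u : GL (Fin 1) E} {m jl : ℕ}
  {H₂ : Matrix (Fin 2) (Fin 2) E} {hW : E} {P₁ : GL (Fin 3) E} {φ : (Fin 2 → E) →+ M} {h : M} {R : ℕ} {f : ℕ → ℕ → AddSubgroup M → ℕ}

/-! ## §1 (W0) `lam ∈ 𝒪_j ⟺ j ≤ jl`, and `m ≤ jl` -/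

/-- **(W0) THE ORDER LEVELS OF `lam` ARE `j ≤ jl`** (RamK lane: `|α − ρα| = 1`, `|jE a| = |a|`, `|ϖ| = exp(−1)`): `IsOrd ρ α (jE ϖ^j) lam ↔ j ≤ jl`, where `exp(−jl) = |μ − ρμ|`,
`μ = lam − jE u₀₀` (`ρ` fixes `jE u₀₀`, so `lam − ρ lam = μ − ρμ`). [cite: Serre1979, Ch. III §6 Prop. 12] [cite: Kottwitz1986BaseChangeUnits, §1 pp. 240–241] -/
theorem isOrd_lam_iff_le (hD : IsRamifiedQuadraticDatum σ ϖ d tE) (hρj : ∀ a, ρ (jE a) = jE a) (hvlam : Valued.v lam = 1)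
    (hU : Valued.v (α - ρ α) = 1) (hjiso : ∀ a, Valued.v (jE a) = Valued.v a)
    (hjl : Valued.v ((lam - jE ((u : Matrix (Fin 1) (Fin 1) E) 0 0)) - ρ (lam - jE ((u : Matrix (Fin 1) (Fin 1) E) 0 0))) = WithZero.exp (-(jl : ℤ))) (j : ℕ) :
    IsOrd ρ α (jE ϖ ^ j) lam ↔ j ≤ jl := by
  have hϖ : Valued.v ϖ = exp (-1 : ℤ) := hD.2.2.1
  have e : (lam - jE ((u : Matrix (Fin 1) (Fin 1) E) 0 0)) - ρ (lam - jE ((u : Matrix (Fin 1) (Fin 1) E) 0 0)) = lam - ρ lam := by rw [map_sub, hρj]; ring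
  rw [isOrd_iff, ← e, hjl, Valuation.map_mul, hU, mul_one, Valuation.map_pow, hjiso, hϖ, ← exp_nsmul, exp_le_exp, nsmul_eq_mul]
  constructor
  · rintro ⟨-, hle⟩; omega
  · intro hle; exact ⟨hvlam.le, by omega⟩

omit [Valued E ℤᵐ⁰] in
/-- **`m ≤ jl`**: `|μ − ρμ| ≤ max(|μ|, |ρμ|) = |μ|`. [cite: Serre1979, Ch. III §6 Prop. 12] -/
theorem m_le_jl (hvρ : ∀ z, Valued.v (ρ z) = Valued.v z)
    (hm : Valued.v (lam - jE ((u : Matrix (Fin 1) (Fin 1) E) 0 0)) = WithZero.exp (-(m : ℤ)))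
    (hjl : Valued.v ((lam - jE ((u : Matrix (Fin 1) (Fin 1) E) 0 0)) - ρ (lam - jE ((u : Matrix (Fin 1) (Fin 1) E) 0 0))) = WithZero.exp (-(jl : ℤ))) : m ≤ jl := by
  have hle := (Valuation.map_sub Valued.v (lam - jE ((u : Matrix (Fin 1) (Fin 1) E) 0 0)) (ρ (lam - jE ((u : Matrix (Fin 1) (Fin 1) E) 0 0)))).trans
    (max_le le_rfl (by rw [hvρ]))
  rw [hm, hjl, exp_le_exp] at hle
  omega

/-! ## §2 (ROW-W) the window: empty cells contribute `0` for every label and weight -/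

section Window

/-- The `cellDiff` form of an empty u-free cell: `levelSet(j, b) = ∅ ⇒ X(j, b) = 0` (★ p861746, both lemmas). [cite: Kottwitz1986BaseChangeUnits, §1 pp. 240–241] -/
theorem cellDiff_eq_zero_of_levelSet_eq_empty {j b : ℕ} (hL : levelSet ρ Θ α (jE ϖ) h j b = ∅) :
    ((∑ᶠ Λ ∈ levelSetDep ρ Θ α (jE ϖ) h j b (lam - jE ((u : Matrix (Fin 1) (Fin 1) E) 0 0)) ∩
                      {Λ | ∃ B : Submodule 𝒪[E] (Fin 2 → E), B.toAddSubgroup.map φ = Λ ∧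
                        ∃ L₃ : Submodule 𝒪[E] (Fin 3 → E), IsSelfDualLattice σ ϖ (!![H₂ 0 0, 0, H₂ 0 1; 0, hW, 0; H₂ 1 0, 0, H₂ 1 1] : Matrix (Fin 3) (Fin 3) E) L₃ ∧
                          L₃ ⊓ LinearMap.ker ((LinearMap.proj (1 : Fin 3) : (Fin 3 → E) →ₗ[E] E).restrictScalars 𝒪[E]) =
                            B.map ((Matrix.toLin' (!![1, 0; 0, 0; 0, 1] : Matrix (Fin 3) (Fin 2) E)).restrictScalars 𝒪[E]) ∧
                          (∀ c : E, (Pi.single 1 c : Fin 3 → E) ∈ L₃ ↔ Valued.v c ≤ Valued.v ϖ ^ b) ∧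
                          (LatticeNearTransvShell ϖ (d % 2) (mstarOfRecord d) ((((endoGL (γ₂, u) : GL (Fin 3) E) : Matrix (Fin 3) (Fin 3) E) - 1)) L₃ ∧
                            {z : E | ∃ y ∈ L₃, Valued.v ((ϖ ^ (mstarOfRecord d))⁻¹ * (z - pairing σ (!![H₂ 0 0, 0, H₂ 0 1; 0, hW, 0; H₂ 1 0, 0, H₂ 1 1] : Matrix (Fin 3) (Fin 3) E) y (((((endoGL (γ₂, u) : GL (Fin 3) E) : Matrix (Fin 3) (Fin 3) E) - 1)) *ᵥ y))) ≤ 1} =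
                              valueSetMod σ ϖ (mstarOfRecord d) (xPlus σ ϖ d))}, f b j Λ : ℕ) : ℤ) -
                  ((∑ᶠ Λ ∈ levelSetDep ρ Θ α (jE ϖ) h j b (lam - jE ((u : Matrix (Fin 1) (Fin 1) E) 0 0)) ∩
                      {Λ | ∃ B : Submodule 𝒪[E] (Fin 2 → E), B.toAddSubgroup.map φ = Λ ∧
                        ∃ L₃ : Submodule 𝒪[E] (Fin 3 → E), IsSelfDualLattice σ ϖ (!![H₂ 0 0, 0, H₂ 0 1; 0, hW, 0; H₂ 1 0, 0, H₂ 1 1] : Matrix (Fin 3) (Fin 3) E) L₃ ∧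
                          L₃ ⊓ LinearMap.ker ((LinearMap.proj (1 : Fin 3) : (Fin 3 → E) →ₗ[E] E).restrictScalars 𝒪[E]) =
                            B.map ((Matrix.toLin' (!![1, 0; 0, 0; 0, 1] : Matrix (Fin 3) (Fin 2) E)).restrictScalars 𝒪[E]) ∧
                          (∀ c : E, (Pi.single 1 c : Fin 3 → E) ∈ L₃ ↔ Valued.v c ≤ Valued.v ϖ ^ b) ∧
                          (LatticeNearTransvShell ϖ (d % 2) (mcOfRecord d) ((((endoGL (γ₂, u) : GL (Fin 3) E) : Matrix (Fin 3) (Fin 3) E) - 1)) L₃ ∧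
                            ¬ {z : E | ∃ y ∈ L₃, Valued.v ((ϖ ^ (mstarOfRecord d))⁻¹ * (z - pairing σ (!![H₂ 0 0, 0, H₂ 0 1; 0, hW, 0; H₂ 1 0, 0, H₂ 1 1] : Matrix (Fin 3) (Fin 3) E) y (((((endoGL (γ₂, u) : GL (Fin 3) E) : Matrix (Fin 3) (Fin 3) E) - 1)) *ᵥ y))) ≤ 1} =
                              valueSetMod σ ϖ (mstarOfRecord d) (xPlus σ ϖ d))}, f b j Λ : ℕ) : ℤ) = 0 :=
  finsum_inter_sub_finsum_inter_eq_zero_of_eq_empty _ (levelSetDep_eq_empty_of_levelSet_eq_empty hL _) _ _ _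

variable [CompleteSpace M] [IsDiscreteValuationRing 𝒪[M]] [Finite 𝓀[M]]

/-- **(W1) BELOW THE TUBE DEPTH: `j < b ⇒ X(j, b) = 0`** (★ `levelSet_eq_empty_of_lt_ramK`, either literal). [cite: Flicker1998UnitaryFL, Prop. 7 p. 84] [cite: Kottwitz1986BaseChangeUnits, §1 pp. 240–241] -/
theorem cellDiff_eq_zero_of_lt (hρρ : ∀ z, ρ (ρ z) = z) (hvρ : ∀ z, Valued.v (ρ z) = Valued.v z) (hρj : ∀ a, ρ (jE a) = jE a)
    (hΘρ : ∀ z, Θ (ρ z) = ρ (Θ z)) (hα1 : Valued.v α ≤ 1) (hU : Valued.v (α - ρ α) = 1) (hτ : Valued.v (α - Θ α) < 1)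
    (hσres : ∀ z : M, ρ z = z → Valued.v z ≤ 1 → Valued.v (Θ z - z) < 1) (hDM : IsRamifiedQuadraticDatum Θ (jE ϖ) d tE)
    (hq : Nat.card 𝓀[M] = Nat.card 𝓀[E] ^ 2) (hΘh : Θ h = h) (hh : h ≠ 0) {j b : ℕ} (hjb : j < b) :
    ((∑ᶠ Λ ∈ levelSetDep ρ Θ α (jE ϖ) h j b (lam - jE ((u : Matrix (Fin 1) (Fin 1) E) 0 0)) ∩
                      {Λ | ∃ B : Submodule 𝒪[E] (Fin 2 → E), B.toAddSubgroup.map φ = Λ ∧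
                        ∃ L₃ : Submodule 𝒪[E] (Fin 3 → E), IsSelfDualLattice σ ϖ (!![H₂ 0 0, 0, H₂ 0 1; 0, hW, 0; H₂ 1 0, 0, H₂ 1 1] : Matrix (Fin 3) (Fin 3) E) L₃ ∧
                          L₃ ⊓ LinearMap.ker ((LinearMap.proj (1 : Fin 3) : (Fin 3 → E) →ₗ[E] E).restrictScalars 𝒪[E]) =
                            B.map ((Matrix.toLin' (!![1, 0; 0, 0; 0, 1] : Matrix (Fin 3) (Fin 2) E)).restrictScalars 𝒪[E]) ∧
                          (∀ c : E, (Pi.single 1 c : Fin 3 → E) ∈ L₃ ↔ Valued.v c ≤ Valued.v ϖ ^ b) ∧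
                          (LatticeNearTransvShell ϖ (d % 2) (mstarOfRecord d) ((((endoGL (γ₂, u) : GL (Fin 3) E) : Matrix (Fin 3) (Fin 3) E) - 1)) L₃ ∧
                            {z : E | ∃ y ∈ L₃, Valued.v ((ϖ ^ (mstarOfRecord d))⁻¹ * (z - pairing σ (!![H₂ 0 0, 0, H₂ 0 1; 0, hW, 0; H₂ 1 0, 0, H₂ 1 1] : Matrix (Fin 3) (Fin 3) E) y (((((endoGL (γ₂, u) : GL (Fin 3) E) : Matrix (Fin 3) (Fin 3) E) - 1)) *ᵥ y))) ≤ 1} =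
                              valueSetMod σ ϖ (mstarOfRecord d) (xPlus σ ϖ d))}, f b j Λ : ℕ) : ℤ) -
                  ((∑ᶠ Λ ∈ levelSetDep ρ Θ α (jE ϖ) h j b (lam - jE ((u : Matrix (Fin 1) (Fin 1) E) 0 0)) ∩
                      {Λ | ∃ B : Submodule 𝒪[E] (Fin 2 → E), B.toAddSubgroup.map φ = Λ ∧
                        ∃ L₃ : Submodule 𝒪[E] (Fin 3 → E), IsSelfDualLattice σ ϖ (!![H₂ 0 0, 0, H₂ 0 1; 0, hW, 0; H₂ 1 0, 0, H₂ 1 1] : Matrix (Fin 3) (Fin 3) E) L₃ ∧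
                          L₃ ⊓ LinearMap.ker ((LinearMap.proj (1 : Fin 3) : (Fin 3 → E) →ₗ[E] E).restrictScalars 𝒪[E]) =
                            B.map ((Matrix.toLin' (!![1, 0; 0, 0; 0, 1] : Matrix (Fin 3) (Fin 2) E)).restrictScalars 𝒪[E]) ∧
                          (∀ c : E, (Pi.single 1 c : Fin 3 → E) ∈ L₃ ↔ Valued.v c ≤ Valued.v ϖ ^ b) ∧
                          (LatticeNearTransvShell ϖ (d % 2) (mcOfRecord d) ((((endoGL (γ₂, u) : GL (Fin 3) E) : Matrix (Fin 3) (Fin 3) E) - 1)) L₃ ∧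
                            ¬ {z : E | ∃ y ∈ L₃, Valued.v ((ϖ ^ (mstarOfRecord d))⁻¹ * (z - pairing σ (!![H₂ 0 0, 0, H₂ 0 1; 0, hW, 0; H₂ 1 0, 0, H₂ 1 1] : Matrix (Fin 3) (Fin 3) E) y (((((endoGL (γ₂, u) : GL (Fin 3) E) : Matrix (Fin 3) (Fin 3) E) - 1)) *ᵥ y))) ≤ 1} =
                              valueSetMod σ ϖ (mstarOfRecord d) (xPlus σ ϖ d))}, f b j Λ : ℕ) : ℤ) = 0 :=
  cellDiff_eq_zero_of_levelSet_eq_empty (levelSet_eq_empty_of_lt_ramK hρρ hvρ hΘρ hα1 hU hDM (hρj ϖ) hΘh hh hq hσres hτ hjb)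

/-- **(W2) THE PARITY GATE: `b ≤ j`, `j − b` odd ⇒ `X(j, b) = 0`** (★ `levelSet_eq_empty_of_odd_ramK`, either literal). [cite: Flicker1998UnitaryFL, Prop. 7 p. 84] [cite: Kottwitz1986BaseChangeUnits, §1 pp. 240–241] -/
theorem cellDiff_eq_zero_of_odd (hρρ : ∀ z, ρ (ρ z) = z) (hvρ : ∀ z, Valued.v (ρ z) = Valued.v z) (hρj : ∀ a, ρ (jE a) = jE a)
    (hΘρ : ∀ z, Θ (ρ z) = ρ (Θ z)) (hα1 : Valued.v α ≤ 1) (hU : Valued.v (α - ρ α) = 1) (hτ : Valued.v (α - Θ α) < 1)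
    (hσres : ∀ z : M, ρ z = z → Valued.v z ≤ 1 → Valued.v (Θ z - z) < 1) (hDM : IsRamifiedQuadraticDatum Θ (jE ϖ) d tE)
    (hq : Nat.card 𝓀[M] = Nat.card 𝓀[E] ^ 2) (hΘh : Θ h = h) (hh : h ≠ 0) {j b : ℕ} (hbj : b ≤ j) (hodd : (j - b) % 2 = 1) :
    ((∑ᶠ Λ ∈ levelSetDep ρ Θ α (jE ϖ) h j b (lam - jE ((u : Matrix (Fin 1) (Fin 1) E) 0 0)) ∩
                      {Λ | ∃ B : Submodule 𝒪[E] (Fin 2 → E), B.toAddSubgroup.map φ = Λ ∧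
                        ∃ L₃ : Submodule 𝒪[E] (Fin 3 → E), IsSelfDualLattice σ ϖ (!![H₂ 0 0, 0, H₂ 0 1; 0, hW, 0; H₂ 1 0, 0, H₂ 1 1] : Matrix (Fin 3) (Fin 3) E) L₃ ∧
                          L₃ ⊓ LinearMap.ker ((LinearMap.proj (1 : Fin 3) : (Fin 3 → E) →ₗ[E] E).restrictScalars 𝒪[E]) =
                            B.map ((Matrix.toLin' (!![1, 0; 0, 0; 0, 1] : Matrix (Fin 3) (Fin 2) E)).restrictScalars 𝒪[E]) ∧
                          (∀ c : E, (Pi.single 1 c : Fin 3 → E) ∈ L₃ ↔ Valued.v c ≤ Valued.v ϖ ^ b) ∧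
                          (LatticeNearTransvShell ϖ (d % 2) (mstarOfRecord d) ((((endoGL (γ₂, u) : GL (Fin 3) E) : Matrix (Fin 3) (Fin 3) E) - 1)) L₃ ∧
                            {z : E | ∃ y ∈ L₃, Valued.v ((ϖ ^ (mstarOfRecord d))⁻¹ * (z - pairing σ (!![H₂ 0 0, 0, H₂ 0 1; 0, hW, 0; H₂ 1 0, 0, H₂ 1 1] : Matrix (Fin 3) (Fin 3) E) y (((((endoGL (γ₂, u) : GL (Fin 3) E) : Matrix (Fin 3) (Fin 3) E) - 1)) *ᵥ y))) ≤ 1} =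
                              valueSetMod σ ϖ (mstarOfRecord d) (xPlus σ ϖ d))}, f b j Λ : ℕ) : ℤ) -
                  ((∑ᶠ Λ ∈ levelSetDep ρ Θ α (jE ϖ) h j b (lam - jE ((u : Matrix (Fin 1) (Fin 1) E) 0 0)) ∩
                      {Λ | ∃ B : Submodule 𝒪[E] (Fin 2 → E), B.toAddSubgroup.map φ = Λ ∧
                        ∃ L₃ : Submodule 𝒪[E] (Fin 3 → E), IsSelfDualLattice σ ϖ (!![H₂ 0 0, 0, H₂ 0 1; 0, hW, 0; H₂ 1 0, 0, H₂ 1 1] : Matrix (Fin 3) (Fin 3) E) L₃ ∧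
                          L₃ ⊓ LinearMap.ker ((LinearMap.proj (1 : Fin 3) : (Fin 3 → E) →ₗ[E] E).restrictScalars 𝒪[E]) =
                            B.map ((Matrix.toLin' (!![1, 0; 0, 0; 0, 1] : Matrix (Fin 3) (Fin 2) E)).restrictScalars 𝒪[E]) ∧
                          (∀ c : E, (Pi.single 1 c : Fin 3 → E) ∈ L₃ ↔ Valued.v c ≤ Valued.v ϖ ^ b) ∧
                          (LatticeNearTransvShell ϖ (d % 2) (mcOfRecord d) ((((endoGL (γ₂, u) : GL (Fin 3) E) : Matrix (Fin 3) (Fin 3) E) - 1)) L₃ ∧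
                            ¬ {z : E | ∃ y ∈ L₃, Valued.v ((ϖ ^ (mstarOfRecord d))⁻¹ * (z - pairing σ (!![H₂ 0 0, 0, H₂ 0 1; 0, hW, 0; H₂ 1 0, 0, H₂ 1 1] : Matrix (Fin 3) (Fin 3) E) y (((((endoGL (γ₂, u) : GL (Fin 3) E) : Matrix (Fin 3) (Fin 3) E) - 1)) *ᵥ y))) ≤ 1} =
                              valueSetMod σ ϖ (mstarOfRecord d) (xPlus σ ϖ d))}, f b j Λ : ℕ) : ℤ) = 0 :=
  cellDiff_eq_zero_of_levelSet_eq_empty (levelSet_eq_empty_of_odd_ramK hρρ hvρ hΘρ hα1 hU hDM (hρj ϖ) hΘh hh hq hσres hτ hbj hodd)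

omit [CompleteSpace M] [IsDiscreteValuationRing 𝒪[M]] [Finite 𝓀[M]] in
/-- **(W3) ON OR BELOW THE ROW, BEYOND `jl`: `2b ≤ m`, `jl < j + b ⇒ X(j, b) = 0`** (★ atlas (∅-2) `cellDiff_eq_zero_of_lt_add` with `m ≤ jl < j + b`; row-predicate free: at the
live row `2b + d % 2 = m` or `2b = m` the letter `2b ≤ m` holds). [cite: Kottwitz1986BaseChangeUnits, §1 pp. 240–241] -/
theorem cellDiff_eq_zero_of_lt_add_row (hD : IsRamifiedQuadraticDatum σ ϖ d tE) (hρρ : ∀ z, ρ (ρ z) = z) (hvρ : ∀ z, Valued.v (ρ z) = Valued.v z)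
    (hρj : ∀ a, ρ (jE a) = jE a) (hΘΘ : ∀ z, Θ (Θ z) = z) (hΘρ : ∀ z, Θ (ρ z) = ρ (Θ z)) (hvΘ : ∀ z, Valued.v (Θ z) = Valued.v z)
    (hα1 : Valued.v α ≤ 1) (hU : Valued.v (α - ρ α) = 1) (hjiso : ∀ a, Valued.v (jE a) = Valued.v a) (hh : h ≠ 0)
    (hm : Valued.v (lam - jE ((u : Matrix (Fin 1) (Fin 1) E) 0 0)) = WithZero.exp (-(m : ℤ)))
    (hjl : Valued.v ((lam - jE ((u : Matrix (Fin 1) (Fin 1) E) 0 0)) - ρ (lam - jE ((u : Matrix (Fin 1) (Fin 1) E) 0 0))) = WithZero.exp (-(jl : ℤ)))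
    {b j : ℕ} (hb1 : 1 ≤ b) (h2b : 2 * b ≤ m) (hjlb : jl < j + b) :
    ((∑ᶠ Λ ∈ levelSetDep ρ Θ α (jE ϖ) h j b (lam - jE ((u : Matrix (Fin 1) (Fin 1) E) 0 0)) ∩
                      {Λ | ∃ B : Submodule 𝒪[E] (Fin 2 → E), B.toAddSubgroup.map φ = Λ ∧
                        ∃ L₃ : Submodule 𝒪[E] (Fin 3 → E), IsSelfDualLattice σ ϖ (!![H₂ 0 0, 0, H₂ 0 1; 0, hW, 0; H₂ 1 0, 0, H₂ 1 1] : Matrix (Fin 3) (Fin 3) E) L₃ ∧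
                          L₃ ⊓ LinearMap.ker ((LinearMap.proj (1 : Fin 3) : (Fin 3 → E) →ₗ[E] E).restrictScalars 𝒪[E]) =
                            B.map ((Matrix.toLin' (!![1, 0; 0, 0; 0, 1] : Matrix (Fin 3) (Fin 2) E)).restrictScalars 𝒪[E]) ∧
                          (∀ c : E, (Pi.single 1 c : Fin 3 → E) ∈ L₃ ↔ Valued.v c ≤ Valued.v ϖ ^ b) ∧
                          (LatticeNearTransvShell ϖ (d % 2) (mstarOfRecord d) ((((endoGL (γ₂, u) : GL (Fin 3) E) : Matrix (Fin 3) (Fin 3) E) - 1)) L₃ ∧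
                            {z : E | ∃ y ∈ L₃, Valued.v ((ϖ ^ (mstarOfRecord d))⁻¹ * (z - pairing σ (!![H₂ 0 0, 0, H₂ 0 1; 0, hW, 0; H₂ 1 0, 0, H₂ 1 1] : Matrix (Fin 3) (Fin 3) E) y (((((endoGL (γ₂, u) : GL (Fin 3) E) : Matrix (Fin 3) (Fin 3) E) - 1)) *ᵥ y))) ≤ 1} =
                              valueSetMod σ ϖ (mstarOfRecord d) (xPlus σ ϖ d))}, f b j Λ : ℕ) : ℤ) -
                  ((∑ᶠ Λ ∈ levelSetDep ρ Θ α (jE ϖ) h j b (lam - jE ((u : Matrix (Fin 1) (Fin 1) E) 0 0)) ∩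
                      {Λ | ∃ B : Submodule 𝒪[E] (Fin 2 → E), B.toAddSubgroup.map φ = Λ ∧
                        ∃ L₃ : Submodule 𝒪[E] (Fin 3 → E), IsSelfDualLattice σ ϖ (!![H₂ 0 0, 0, H₂ 0 1; 0, hW, 0; H₂ 1 0, 0, H₂ 1 1] : Matrix (Fin 3) (Fin 3) E) L₃ ∧
                          L₃ ⊓ LinearMap.ker ((LinearMap.proj (1 : Fin 3) : (Fin 3 → E) →ₗ[E] E).restrictScalars 𝒪[E]) =
                            B.map ((Matrix.toLin' (!![1, 0; 0, 0; 0, 1] : Matrix (Fin 3) (Fin 2) E)).restrictScalars 𝒪[E]) ∧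
                          (∀ c : E, (Pi.single 1 c : Fin 3 → E) ∈ L₃ ↔ Valued.v c ≤ Valued.v ϖ ^ b) ∧
                          (LatticeNearTransvShell ϖ (d % 2) (mcOfRecord d) ((((endoGL (γ₂, u) : GL (Fin 3) E) : Matrix (Fin 3) (Fin 3) E) - 1)) L₃ ∧
                            ¬ {z : E | ∃ y ∈ L₃, Valued.v ((ϖ ^ (mstarOfRecord d))⁻¹ * (z - pairing σ (!![H₂ 0 0, 0, H₂ 0 1; 0, hW, 0; H₂ 1 0, 0, H₂ 1 1] : Matrix (Fin 3) (Fin 3) E) y (((((endoGL (γ₂, u) : GL (Fin 3) E) : Matrix (Fin 3) (Fin 3) E) - 1)) *ᵥ y))) ≤ 1} =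
                              valueSetMod σ ϖ (mstarOfRecord d) (xPlus σ ϖ d))}, f b j Λ : ℕ) : ℤ) = 0 := by
  have hϖE : Valued.v (jE ϖ) = exp (-1 : ℤ) := by rw [hjiso]; exact hD.2.2.1
  have hmjl := m_le_jl hvρ hm hjl
  exact cellDiff_eq_zero_of_lt_add hρρ hvρ hΘΘ hΘρ hvΘ hα1 hU (hρj ϖ) hϖE hh hm hjl hb1 h2b (by omega) hjlb _ _ _

/-- **(W4) THE ANISOTROPIC FAR ROWS: `1 ≤ b`, `b + 2d ≤ j ⇒ X(j, b) = 0`** at the anisotropic literal, PARITY-FREE (★ `levelSet_far_ramK_aniso_eq_empty` for `j − b` even, (W2) for odd).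
[cite: Flicker1998UnitaryFL, Prop. 7 p. 84] [cite: Kottwitz1986BaseChangeUnits, §1 pp. 240–241] -/
theorem cellDiff_eq_zero_of_far_aniso (hρρ : ∀ z, ρ (ρ z) = z) (hvρ : ∀ z, Valued.v (ρ z) = Valued.v z) (hρj : ∀ a, ρ (jE a) = jE a)
    (hΘρ : ∀ z, Θ (ρ z) = ρ (Θ z)) (hα1 : Valued.v α ≤ 1) (hU : Valued.v (α - ρ α) = 1) (hτ : Valued.v (α - Θ α) < 1)
    (hσres : ∀ z : M, ρ z = z → Valued.v z ≤ 1 → Valued.v (Θ z - z) < 1) (hDM : IsRamifiedQuadraticDatum Θ (jE ϖ) d tE)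
    (hq : Nat.card 𝓀[M] = Nat.card 𝓀[E] ^ 2) (hΘh : Θ h = h) (hh : h ≠ 0) (haniso : ¬ ∃ x : M, x ≠ 0 ∧ h * Θ x * x + ρ (h * Θ x * x) = 0)
    {j b : ℕ} (hb1 : 1 ≤ b) (hfar : b + 2 * d ≤ j) :
    ((∑ᶠ Λ ∈ levelSetDep ρ Θ α (jE ϖ) h j b (lam - jE ((u : Matrix (Fin 1) (Fin 1) E) 0 0)) ∩
                      {Λ | ∃ B : Submodule 𝒪[E] (Fin 2 → E), B.toAddSubgroup.map φ = Λ ∧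
                        ∃ L₃ : Submodule 𝒪[E] (Fin 3 → E), IsSelfDualLattice σ ϖ (!![H₂ 0 0, 0, H₂ 0 1; 0, hW, 0; H₂ 1 0, 0, H₂ 1 1] : Matrix (Fin 3) (Fin 3) E) L₃ ∧
                          L₃ ⊓ LinearMap.ker ((LinearMap.proj (1 : Fin 3) : (Fin 3 → E) →ₗ[E] E).restrictScalars 𝒪[E]) =
                            B.map ((Matrix.toLin' (!![1, 0; 0, 0; 0, 1] : Matrix (Fin 3) (Fin 2) E)).restrictScalars 𝒪[E]) ∧
                          (∀ c : E, (Pi.single 1 c : Fin 3 → E) ∈ L₃ ↔ Valued.v c ≤ Valued.v ϖ ^ b) ∧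
                          (LatticeNearTransvShell ϖ (d % 2) (mstarOfRecord d) ((((endoGL (γ₂, u) : GL (Fin 3) E) : Matrix (Fin 3) (Fin 3) E) - 1)) L₃ ∧
                            {z : E | ∃ y ∈ L₃, Valued.v ((ϖ ^ (mstarOfRecord d))⁻¹ * (z - pairing σ (!![H₂ 0 0, 0, H₂ 0 1; 0, hW, 0; H₂ 1 0, 0, H₂ 1 1] : Matrix (Fin 3) (Fin 3) E) y (((((endoGL (γ₂, u) : GL (Fin 3) E) : Matrix (Fin 3) (Fin 3) E) - 1)) *ᵥ y))) ≤ 1} =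
                              valueSetMod σ ϖ (mstarOfRecord d) (xPlus σ ϖ d))}, f b j Λ : ℕ) : ℤ) -
                  ((∑ᶠ Λ ∈ levelSetDep ρ Θ α (jE ϖ) h j b (lam - jE ((u : Matrix (Fin 1) (Fin 1) E) 0 0)) ∩
                      {Λ | ∃ B : Submodule 𝒪[E] (Fin 2 → E), B.toAddSubgroup.map φ = Λ ∧
                        ∃ L₃ : Submodule 𝒪[E] (Fin 3 → E), IsSelfDualLattice σ ϖ (!![H₂ 0 0, 0, H₂ 0 1; 0, hW, 0; H₂ 1 0, 0, H₂ 1 1] : Matrix (Fin 3) (Fin 3) E) L₃ ∧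
                          L₃ ⊓ LinearMap.ker ((LinearMap.proj (1 : Fin 3) : (Fin 3 → E) →ₗ[E] E).restrictScalars 𝒪[E]) =
                            B.map ((Matrix.toLin' (!![1, 0; 0, 0; 0, 1] : Matrix (Fin 3) (Fin 2) E)).restrictScalars 𝒪[E]) ∧
                          (∀ c : E, (Pi.single 1 c : Fin 3 → E) ∈ L₃ ↔ Valued.v c ≤ Valued.v ϖ ^ b) ∧
                          (LatticeNearTransvShell ϖ (d % 2) (mcOfRecord d) ((((endoGL (γ₂, u) : GL (Fin 3) E) : Matrix (Fin 3) (Fin 3) E) - 1)) L₃ ∧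
                            ¬ {z : E | ∃ y ∈ L₃, Valued.v ((ϖ ^ (mstarOfRecord d))⁻¹ * (z - pairing σ (!![H₂ 0 0, 0, H₂ 0 1; 0, hW, 0; H₂ 1 0, 0, H₂ 1 1] : Matrix (Fin 3) (Fin 3) E) y (((((endoGL (γ₂, u) : GL (Fin 3) E) : Matrix (Fin 3) (Fin 3) E) - 1)) *ᵥ y))) ≤ 1} =
                              valueSetMod σ ϖ (mstarOfRecord d) (xPlus σ ϖ d))}, f b j Λ : ℕ) : ℤ) = 0 := by
  by_cases hpar : (j - b) % 2 = 0
  · exact cellDiff_eq_zero_of_levelSet_eq_empty (levelSet_far_ramK_aniso_eq_empty hρρ hvρ hΘρ hα1 hU hDM (hρj ϖ) hΘh hh hq hσres hτ haniso hb1 hfar hpar)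
  · exact cellDiff_eq_zero_of_odd hρρ hvρ hρj hΘρ hα1 hU hτ hσres hDM hq hΘh hh (by omega) (by omega)

end Window

/-! ## §3 (ROW-R) a labelled vertex is `Γ`-fixed, hence has tube depth `≤ R` -/

/-- **A SELF-DUAL VERTEX IN THE LEVEL-`ℓ` LOCUS OF `Γ − 1` IS `Γ`-FIXED**: `(Γ − 1)L₃ ⊆ ϖ^ℓ L₃ ⊆ L₃` gives `Γ L₃ ⊆ L₃`; `Γ L₃` is self-dual for `Γ ∈ U(H)` (★ `isVertexLattice_mapGL`), and
comparable self-dual vertices are equal (★ `eq_of_le_of_isVertexLattice`). [cite: Jacobowitz1962, §7] [cite: Kottwitz1986BaseChangeUnits, §3] -/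
theorem mapGL_eq_of_latticeInLevel (hvσ : ∀ a, Valued.v (σ a) = Valued.v a) (hϖ0 : ϖ ≠ 0) (hϖ1 : Valued.v ϖ ≤ 1)
    {H : Matrix (Fin 3) (Fin 3) E} {Γ : GL (Fin 3) E} (hΓ : Γ ∈ unitaryGroupOfForm σ H) {L₃ : Submodule 𝒪[E] (Fin 3 → E)}
    (hSD : IsSelfDualLattice σ ϖ H L₃) {ℓ : ℕ} (hlev : LatticeInLevel ϖ ℓ (((Γ : GL (Fin 3) E) : Matrix (Fin 3) (Fin 3) E) - 1) L₃) :
    mapGL Γ L₃ = L₃ := by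
  refine eq_of_le_of_isVertexLattice hvσ hϖ0 (isVertexLattice_mapGL σ ϖ H Γ hΓ hSD) hSD fun y hy => ?_
  obtain ⟨x, hx, rfl⟩ := Submodule.mem_map.1 hy
  -- `Γ x = x + (Γ − 1) x`, and `(Γ − 1) x ∈ ϖ^ℓ L₃ ⊆ L₃`
  have hXx : ((Matrix.toLin' ((((Γ : GL (Fin 3) E) : Matrix (Fin 3) (Fin 3) E) - 1))).restrictScalars 𝒪[E]) x ∈ scaleLattice (ϖ ^ ℓ) L₃ :=
    hlev (Submodule.mem_map_of_mem hx)
  obtain ⟨z, hz, hzx⟩ := Submodule.mem_map.1 hXx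
  have hzL : (ϖ ^ ℓ) • z ∈ L₃ := by
    have e : (ϖ ^ ℓ) • z = ((⟨ϖ ^ ℓ, by rw [Valuation.mem_integer_iff, map_pow]; exact pow_le_one₀ zero_le hϖ1⟩ : 𝒪[E]) : 𝒪[E]) • z := rfl
    rw [e]; exact L₃.smul_mem _ hz
  have e1 : ((Matrix.toLin' ((Γ : GL (Fin 3) E) : Matrix (Fin 3) (Fin 3) E)).restrictScalars 𝒪[E]) x =
      x + ((Matrix.toLin' ((((Γ : GL (Fin 3) E) : Matrix (Fin 3) (Fin 3) E) - 1))).restrictScalars 𝒪[E]) x := by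
    simp
  rw [e1, ← hzx]
  exact L₃.add_mem hx (by simpa using hzL)

/-- **(R-vertex) A SHELL-LABELLED SELF-DUAL VERTEX OF TUBE DEPTH `b` HAS `b ≤ R`**: in ‹OFF›'s currency (`hA`: the frame `formCongr σ P₁ Φ₃ = ι-shape(H₂, h_W)`, `hΓ`:
`P₁ ι(γ₂, u) P₁⁻¹ ∈ U(σ, Φ₃)`, `hR`: every `Γ`-fixed self-dual vertex of tube depth `b` has `b ≤ R`), the first conjunct `LatticeInLevel ϖ ℓ (Γ − 1) L₃` of a shell label already
forces `Γ L₃ = L₃` (★ `conj_mem_unitaryGroupOfForm_iff` + `mapGL_eq_of_latticeInLevel`). [cite: Jacobowitz1962, §7] [cite: Kottwitz1986BaseChangeUnits, §3] -/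
theorem le_of_shell_of_tube (hD : IsRamifiedQuadraticDatum σ ϖ d tE)
    (hA : formCongr σ P₁ ((StdForm.antidiagonal 3).over E) = (!![H₂ 0 0, 0, H₂ 0 1; 0, hW, 0; H₂ 1 0, 0, H₂ 1 1] : Matrix (Fin 3) (Fin 3) E))
    (hΓ : P₁ * endoGL (γ₂, u) * P₁⁻¹ ∈ unitaryGroupOfForm σ ((StdForm.antidiagonal 3).over E))
    (hR : ∀ L₃ : Submodule 𝒪[E] (Fin 3 → E), IsSelfDualLattice σ ϖ (!![H₂ 0 0, 0, H₂ 0 1; 0, hW, 0; H₂ 1 0, 0, H₂ 1 1] : Matrix (Fin 3) (Fin 3) E) L₃ →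
      mapGL (endoGL (γ₂, u)) L₃ = L₃ → ∀ b : ℕ, (∀ c : E, (Pi.single 1 c : Fin 3 → E) ∈ L₃ ↔ Valued.v c ≤ Valued.v ϖ ^ b) → b ≤ R)
    {b ℓ : ℕ} {L₃ : Submodule 𝒪[E] (Fin 3 → E)} (hSD : IsSelfDualLattice σ ϖ (!![H₂ 0 0, 0, H₂ 0 1; 0, hW, 0; H₂ 1 0, 0, H₂ 1 1] : Matrix (Fin 3) (Fin 3) E) L₃)
    (htube : ∀ c : E, (Pi.single 1 c : Fin 3 → E) ∈ L₃ ↔ Valued.v c ≤ Valued.v ϖ ^ b) (hlev : LatticeInLevel ϖ ℓ (((endoGL (γ₂, u) : GL (Fin 3) E) : Matrix (Fin 3) (Fin 3) E) - 1) L₃) : b ≤ R := by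
  have hvσ : ∀ a, Valued.v (σ a) = Valued.v a := hD.2.1
  have hϖ : Valued.v ϖ = exp (-1 : ℤ) := hD.2.2.1
  have hϖ0 : ϖ ≠ 0 := fun h0 => by rw [h0, map_zero] at hϖ; exact zero_ne_coe hϖ
  have hϖ1 : Valued.v ϖ ≤ 1 := by rw [hϖ, ← exp_zero, exp_le_exp]; norm_num
  have hΓ' : endoGL (γ₂, u) ∈ unitaryGroupOfForm σ (!![H₂ 0 0, 0, H₂ 0 1; 0, hW, 0; H₂ 1 0, 0, H₂ 1 1] : Matrix (Fin 3) (Fin 3) E) := by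
    rw [← hA]; exact (conj_mem_unitaryGroupOfForm_iff σ P₁ _ (endoGL (γ₂, u))).1 hΓ
  exact hR L₃ hSD (mapGL_eq_of_latticeInLevel hvσ hϖ0 hϖ1 hΓ' hSD hlev) b htube

/-- **(R-cell) TUBE DEPTHS BEYOND `R` CONTRIBUTE `0`: `R < b ⇒ X(j, b) = 0`** — both labelled subsets of the cell are EMPTY, since each label carries a self-dual `L₃` of tube depth `b` on a
`(Γ − 1)`-shell, whose `LatticeInLevel` conjunct gives `b ≤ R` (`le_of_shell_of_tube`).  So on each literal the bare row sum over `b` equals the `Icc 1 R`-filtered one.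
[cite: Kottwitz1986BaseChangeUnits, §1 pp. 240–241, §3] [cite: Jacobowitz1962, §7] -/
theorem cellDiff_eq_zero_of_lt_depth (hD : IsRamifiedQuadraticDatum σ ϖ d tE)
    (hA : formCongr σ P₁ ((StdForm.antidiagonal 3).over E) = (!![H₂ 0 0, 0, H₂ 0 1; 0, hW, 0; H₂ 1 0, 0, H₂ 1 1] : Matrix (Fin 3) (Fin 3) E))
    (hΓ : P₁ * endoGL (γ₂, u) * P₁⁻¹ ∈ unitaryGroupOfForm σ ((StdForm.antidiagonal 3).over E))
    (hR : ∀ L₃ : Submodule 𝒪[E] (Fin 3 → E), IsSelfDualLattice σ ϖ (!![H₂ 0 0, 0, H₂ 0 1; 0, hW, 0; H₂ 1 0, 0, H₂ 1 1] : Matrix (Fin 3) (Fin 3) E) L₃ →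
      mapGL (endoGL (γ₂, u)) L₃ = L₃ → ∀ b : ℕ, (∀ c : E, (Pi.single 1 c : Fin 3 → E) ∈ L₃ ↔ Valued.v c ≤ Valued.v ϖ ^ b) → b ≤ R)
    {j b : ℕ} (hRb : R < b) :
    ((∑ᶠ Λ ∈ levelSetDep ρ Θ α (jE ϖ) h j b (lam - jE ((u : Matrix (Fin 1) (Fin 1) E) 0 0)) ∩
                      {Λ | ∃ B : Submodule 𝒪[E] (Fin 2 → E), B.toAddSubgroup.map φ = Λ ∧
                        ∃ L₃ : Submodule 𝒪[E] (Fin 3 → E), IsSelfDualLattice σ ϖ (!![H₂ 0 0, 0, H₂ 0 1; 0, hW, 0; H₂ 1 0, 0, H₂ 1 1] : Matrix (Fin 3) (Fin 3) E) L₃ ∧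
                          L₃ ⊓ LinearMap.ker ((LinearMap.proj (1 : Fin 3) : (Fin 3 → E) →ₗ[E] E).restrictScalars 𝒪[E]) =
                            B.map ((Matrix.toLin' (!![1, 0; 0, 0; 0, 1] : Matrix (Fin 3) (Fin 2) E)).restrictScalars 𝒪[E]) ∧
                          (∀ c : E, (Pi.single 1 c : Fin 3 → E) ∈ L₃ ↔ Valued.v c ≤ Valued.v ϖ ^ b) ∧
                          (LatticeNearTransvShell ϖ (d % 2) (mstarOfRecord d) ((((endoGL (γ₂, u) : GL (Fin 3) E) : Matrix (Fin 3) (Fin 3) E) - 1)) L₃ ∧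
                            {z : E | ∃ y ∈ L₃, Valued.v ((ϖ ^ (mstarOfRecord d))⁻¹ * (z - pairing σ (!![H₂ 0 0, 0, H₂ 0 1; 0, hW, 0; H₂ 1 0, 0, H₂ 1 1] : Matrix (Fin 3) (Fin 3) E) y (((((endoGL (γ₂, u) : GL (Fin 3) E) : Matrix (Fin 3) (Fin 3) E) - 1)) *ᵥ y))) ≤ 1} =
                              valueSetMod σ ϖ (mstarOfRecord d) (xPlus σ ϖ d))}, f b j Λ : ℕ) : ℤ) -
                  ((∑ᶠ Λ ∈ levelSetDep ρ Θ α (jE ϖ) h j b (lam - jE ((u : Matrix (Fin 1) (Fin 1) E) 0 0)) ∩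
                      {Λ | ∃ B : Submodule 𝒪[E] (Fin 2 → E), B.toAddSubgroup.map φ = Λ ∧
                        ∃ L₃ : Submodule 𝒪[E] (Fin 3 → E), IsSelfDualLattice σ ϖ (!![H₂ 0 0, 0, H₂ 0 1; 0, hW, 0; H₂ 1 0, 0, H₂ 1 1] : Matrix (Fin 3) (Fin 3) E) L₃ ∧
                          L₃ ⊓ LinearMap.ker ((LinearMap.proj (1 : Fin 3) : (Fin 3 → E) →ₗ[E] E).restrictScalars 𝒪[E]) =
                            B.map ((Matrix.toLin' (!![1, 0; 0, 0; 0, 1] : Matrix (Fin 3) (Fin 2) E)).restrictScalars 𝒪[E]) ∧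
                          (∀ c : E, (Pi.single 1 c : Fin 3 → E) ∈ L₃ ↔ Valued.v c ≤ Valued.v ϖ ^ b) ∧
                          (LatticeNearTransvShell ϖ (d % 2) (mcOfRecord d) ((((endoGL (γ₂, u) : GL (Fin 3) E) : Matrix (Fin 3) (Fin 3) E) - 1)) L₃ ∧
                            ¬ {z : E | ∃ y ∈ L₃, Valued.v ((ϖ ^ (mstarOfRecord d))⁻¹ * (z - pairing σ (!![H₂ 0 0, 0, H₂ 0 1; 0, hW, 0; H₂ 1 0, 0, H₂ 1 1] : Matrix (Fin 3) (Fin 3) E) y (((((endoGL (γ₂, u) : GL (Fin 3) E) : Matrix (Fin 3) (Fin 3) E) - 1)) *ᵥ y))) ≤ 1} =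
                              valueSetMod σ ϖ (mstarOfRecord d) (xPlus σ ϖ d))}, f b j Λ : ℕ) : ℤ) = 0 := by
  have hP : levelSetDep ρ Θ α (jE ϖ) h j b (lam - jE ((u : Matrix (Fin 1) (Fin 1) E) 0 0)) ∩ {Λ | ∃ B : Submodule 𝒪[E] (Fin 2 → E), B.toAddSubgroup.map φ = Λ ∧
                        ∃ L₃ : Submodule 𝒪[E] (Fin 3 → E), IsSelfDualLattice σ ϖ (!![H₂ 0 0, 0, H₂ 0 1; 0, hW, 0; H₂ 1 0, 0, H₂ 1 1] : Matrix (Fin 3) (Fin 3) E) L₃ ∧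
                          L₃ ⊓ LinearMap.ker ((LinearMap.proj (1 : Fin 3) : (Fin 3 → E) →ₗ[E] E).restrictScalars 𝒪[E]) =
                            B.map ((Matrix.toLin' (!![1, 0; 0, 0; 0, 1] : Matrix (Fin 3) (Fin 2) E)).restrictScalars 𝒪[E]) ∧
                          (∀ c : E, (Pi.single 1 c : Fin 3 → E) ∈ L₃ ↔ Valued.v c ≤ Valued.v ϖ ^ b) ∧
                          (LatticeNearTransvShell ϖ (d % 2) (mstarOfRecord d) ((((endoGL (γ₂, u) : GL (Fin 3) E) : Matrix (Fin 3) (Fin 3) E) - 1)) L₃ ∧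
                            {z : E | ∃ y ∈ L₃, Valued.v ((ϖ ^ (mstarOfRecord d))⁻¹ * (z - pairing σ (!![H₂ 0 0, 0, H₂ 0 1; 0, hW, 0; H₂ 1 0, 0, H₂ 1 1] : Matrix (Fin 3) (Fin 3) E) y (((((endoGL (γ₂, u) : GL (Fin 3) E) : Matrix (Fin 3) (Fin 3) E) - 1)) *ᵥ y))) ≤ 1} =
                              valueSetMod σ ϖ (mstarOfRecord d) (xPlus σ ϖ d))} = ∅ := by
    refine Set.eq_empty_of_forall_notMem fun Λ hΛ => ?_
    obtain ⟨-, B, -, L₃, hSD, -, htube, hsh, -⟩ := hΛ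
    exact absurd (le_of_shell_of_tube hD hA hΓ hR hSD htube hsh.1) (by omega)
  have hQ : levelSetDep ρ Θ α (jE ϖ) h j b (lam - jE ((u : Matrix (Fin 1) (Fin 1) E) 0 0)) ∩ {Λ | ∃ B : Submodule 𝒪[E] (Fin 2 → E), B.toAddSubgroup.map φ = Λ ∧
                        ∃ L₃ : Submodule 𝒪[E] (Fin 3 → E), IsSelfDualLattice σ ϖ (!![H₂ 0 0, 0, H₂ 0 1; 0, hW, 0; H₂ 1 0, 0, H₂ 1 1] : Matrix (Fin 3) (Fin 3) E) L₃ ∧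
                          L₃ ⊓ LinearMap.ker ((LinearMap.proj (1 : Fin 3) : (Fin 3 → E) →ₗ[E] E).restrictScalars 𝒪[E]) =
                            B.map ((Matrix.toLin' (!![1, 0; 0, 0; 0, 1] : Matrix (Fin 3) (Fin 2) E)).restrictScalars 𝒪[E]) ∧
                          (∀ c : E, (Pi.single 1 c : Fin 3 → E) ∈ L₃ ↔ Valued.v c ≤ Valued.v ϖ ^ b) ∧
                          (LatticeNearTransvShell ϖ (d % 2) (mcOfRecord d) ((((endoGL (γ₂, u) : GL (Fin 3) E) : Matrix (Fin 3) (Fin 3) E) - 1)) L₃ ∧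
                            ¬ {z : E | ∃ y ∈ L₃, Valued.v ((ϖ ^ (mstarOfRecord d))⁻¹ * (z - pairing σ (!![H₂ 0 0, 0, H₂ 0 1; 0, hW, 0; H₂ 1 0, 0, H₂ 1 1] : Matrix (Fin 3) (Fin 3) E) y (((((endoGL (γ₂, u) : GL (Fin 3) E) : Matrix (Fin 3) (Fin 3) E) - 1)) *ᵥ y))) ≤ 1} =
                              valueSetMod σ ϖ (mstarOfRecord d) (xPlus σ ϖ d))} = ∅ := by
    refine Set.eq_empty_of_forall_notMem fun Λ hΛ => ?_
    obtain ⟨-, B, -, L₃, hSD, -, htube, hsh, -⟩ := hΛ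
    exact absurd (le_of_shell_of_tube hD hA hΓ hR hSD htube hsh.1) (by omega)
  rw [hP, hQ, finsum_mem_empty, Nat.cast_zero, sub_zero]

end Summit.HodgeConjecture.HodgeConjecture.Cruxes.H413.F0P3cDyRamBeta2ConesRowWindow

end
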